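import Summits.QuantumFields.QCD.Theses.QuarksAsStableAction
import HarnessLib

/-!
# Route `QuarksAsStableAction` (QCD): the glue item `StableActionBridgeOfPieces` (stmt-QuantumFields-18329)

`ThresholdQCD → MassContinuation → ChiralTupleGapless → StableActionBridge`, through a genuine
**`ChiralCompletion` from the two statement-shaped pieces** (`chiralCompletion_of_pieces`) — the LEAST-ADMISSIBLE-THRESHOLD
argument with `m_crit` re-centring — followed by the lossless split `QCD ↔ ThresholdQCD ∧ ChiralCompletion` (pure logic, as in the tree's
`Theorems/QuarksAsStableActionStableActionBridgeOfSplit.lean`, inlined here to keep this file's imports route-file-only).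

For the regularisation `reg` of the threshold hypothesis let `S = {M | the QCD body holds at every mass tuple with all
components > M}`; `S ∋ M₀` is an up-set.  `S` is bounded below: otherwise the body — hence a uniform lattice gap, the gap
clause being blind to the species renormalisations — would hold at the gapless tuple of `ChiralTupleGapless`.  Its infimum
`M⋆` belongs to `S` (finitely many flavours), and at `M⋆` no rate `ε` is a uniform gap above `M⋆`, for `MassContinuation`
would then lower the threshold below the infimum.  Re-centring `m_crit ↦ m_crit + a M⋆/Z_m` (same `Z_m`, so mass scaling is
kept) turns «all components > M⋆» into «all components > 0»: the re-centred regularisation has the body at every positive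
tuple and is chiral at zero, i.e. `QCDOf N_f`.  Pure order/real bookkeeping over the route's decls; nothing analytic is
asserted; the cruxes `MassContinuation`, `ChiralTupleGapless`, `ThresholdQCD` remain OPEN and no summit, leg or crux statement
is proved (width seat ym-t4-w17 g0, free hands; the item carried an unlanded strategist candidate of 2026-08-17, unreadable
from this seat — re-derived here).
-/

set_option autoImplicit false

namespace Summit.QuantumFields.QCD.Theorems

open Filter Literature.MathematicalPhysics.QuantumFieldTheory
open Summit.QuantumFields.QCD.Theses.QuarksAsStableAction
  (ThresholdQCD MassContinuation ChiralTupleGapless ChiralCompletion StableActionBridge StableActionBridgeOfPieces)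

/-- **`ChiralCompletion` from the pieces** (least admissible threshold + `m_crit` re-centring). [folklore] -/
theorem chiralCompletion_of_pieces (hMC : MassContinuation) (hCT : ChiralTupleGapless) : ChiralCompletion := by
  intro Nf hNf hthr
  obtain ⟨M₀, -, reg, hms, hbody⟩ := hthr
  have hne : (Finset.univ : Finset (Fin Nf)).Nonempty := by
    rcases hNf with rfl | rfl <;> exact ⟨⟨0, by omega⟩, Finset.mem_univ _⟩
  -- the set of admissible thresholds
  set S : Set ℝ := {M : ℝ | ∀ m : Fin Nf → ℝ, (∀ f, M < m f) →
    ∃ (z shift : QCDField Nf → ℕ → ℝ) (T : OSData (QCDField Nf) 4),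
      IsQCDAlong (reg.scheme m z shift) T ∧ T.IsNontrivial QCDField.glue ∧ T.IsNonGaussian QCDField.glue ∧
        (∀ f g : Fin Nf, f ≠ g → T.IsNontrivial (QCDField.pseudoRe f g)) ∧
          ∃ Δ > 0, T.HasMassGap Δ ∧ (reg.scheme m z shift).HasLatticeMassGap Δ} with hSdef
  have hM₀ : M₀ ∈ S := hbody
  have hSne : S.Nonempty := ⟨M₀, hM₀⟩
  have hup : ∀ {M M' : ℝ}, M ∈ S → M ≤ M' → M' ∈ S :=
    fun hM hle m hm => hM m fun f => lt_of_le_of_lt hle (hm f)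
  -- `S` is bounded below (by the gapless tuple of `ChiralTupleGapless`)
  obtain ⟨m₀, hm₀⟩ := hCT Nf hNf reg M₀ hms hbody
  have hbdd : BddBelow S := by
    refine ⟨-(∑ f, |m₀ f|) - 1, fun M hM => ?_⟩
    by_contra hlt
    push Not at hlt
    have hMm : ∀ f, M < m₀ f := fun f => by
      have h1 : |m₀ f| ≤ ∑ g, |m₀ g| :=
        Finset.single_le_sum (f := fun g => |m₀ g|) (fun _ _ => abs_nonneg _) (Finset.mem_univ f)
      have h2 : -|m₀ f| ≤ m₀ f := neg_abs_le _
      linarith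
    obtain ⟨z, s, T, -, -, -, -, Δ, hΔ, -, hgap⟩ := hM m₀ hMm
    exact hm₀ Δ hΔ hgap
  -- the least admissible threshold belongs to `S`
  set Ms : ℝ := sInf S with hMs
  have hMsS : Ms ∈ S := by
    intro m hm
    obtain ⟨f₀, -, hf₀⟩ := Finset.exists_min_image Finset.univ m hne
    obtain ⟨M, hM, hMlt⟩ := exists_lt_of_csInf_lt hSne (hm f₀)
    exact hM m fun f => lt_of_lt_of_le hMlt (hf₀ f (Finset.mem_univ f))
  -- at `M⋆` no rate is a uniform gap above the threshold
  have hsoft : ∀ ε > (0 : ℝ), ∃ m : Fin Nf → ℝ, (∀ f, Ms < m f) ∧ ¬ (reg.scheme m 0 0).HasLatticeMassGap ε := by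
    intro ε hε
    by_contra hcon
    push Not at hcon
    obtain ⟨δ, hδ, hbelow⟩ := hMC Nf hNf reg Ms ε hms hε hMsS hcon
    have hmem : Ms - δ ∈ S := hbelow
    have := csInf_le hbdd hmem
    linarith
  -- the re-centred regularisation
  let reg₀ : QCDRegularisation Nf := { reg with mcrit := fun k => reg.mcrit k + reg.a k * Ms / reg.Zm k }
  have hs : ∀ (m : Fin Nf → ℝ) (z shift : QCDField Nf → ℕ → ℝ),
      reg₀.scheme m z shift = reg.scheme (fun f => Ms + m f) z shift := by
    intro m z shift
    simp only [reg₀, QCDRegularisation.scheme, QCDScheme.mk.injEq, true_and, and_true]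
    funext f k
    ring
  refine ⟨reg₀, hms, fun ε hε => ?_, fun m hm => ?_⟩
  · -- chirality at zero
    obtain ⟨m, hm, hng⟩ := hsoft ε hε
    refine ⟨fun f => m f - Ms, fun f => sub_pos.mpr (hm f), ?_⟩
    rw [hs]
    have : (fun f => Ms + (m f - Ms)) = m := funext fun f => by ring
    rwa [this]
  · -- the body at every positive tuple
    obtain ⟨z, s, T, hT⟩ := hMsS (fun f => Ms + m f) fun f => by linarith [hm f]
    exact ⟨z, s, T, by rw [hs]; exact hT⟩

/-- **Item stmt-QuantumFields-18329 `QuarksAsStableAction.StableActionBridgeOfPieces` holds.** [folklore] -/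
theorem quarksAsStableAction_stableActionBridgeOfPieces_proof :
    Summit.QuantumFields.QCD.Theses.QuarksAsStableAction.StableActionBridgeOfPieces := by
  intro hT hMC hCT _ _
  have hC := chiralCompletion_of_pieces hMC hCT
  exact ⟨hC 2 (Or.inl rfl) (hT 2 (Or.inl rfl)), hC 3 (Or.inr rfl) (hT 3 (Or.inr rfl))⟩

end Summit.QuantumFields.QCD.Theorems
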